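import Literature.AlgebraicGeometry.Resolution.AffineBlowup
import Literature.AlgebraicGeometry.Resolution.QuasiRegularSequences
import Mathlib.RingTheory.Polynomial.Quotient
import HarnessLib

/-!
# The chart of the blowing up of a quasi-regular sequence modulo the exceptional divisor

Topic: `Literature/AlgebraicGeometry/Resolution`. PROVED over Mathlib and the tree
(`AffineBlowup.lean`: the Rees algebra `R[It]`, the chart rings `(R[It])_{(at)} = R[I/a]` of
`Bl_I(Spec R) = Proj R[It]`, `reesChartBase : R → (R[It])_{(at)}`, on which `I` becomes the
principal ideal of the regular element `a/1`; `QuasiRegularSequences.lean`: Matsumura's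
quasi-regular sequences, `IsQuasiRegular`, and Rees' theorem that `R`-sequences are
quasi-regular): for a **quasi-regular** sequence `x = (x_1, …, x_r)` in `R`, `I = (x)`, the chart
ring of the blowing up at `x_i t` modulo the exceptional divisor is a polynomial ring over the
centre,

  `(R[It])_{(x_i t)} ⧸ (x_i) ≅ (R ⧸ I)[T_j : j ≠ i]`, `T_j ↦ (x_j t)/(x_i t)`

(`nonempty_ringEquiv_mvPolynomial_quotient_chart`). This is the algebra behind "the exceptional
divisor of the blowing up of a regular scheme along a regular centre is a projective bundle over
the centre, and the blowing up is regular" (GW Example 13.95 for a point; Liu Thm. 8.1.19), the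
input for the regularity of Hironaka-permissible blowing ups (Cossart–Piltant Thm. 1.5,
Prop. 4.4). Stacks 0BIQ proves the finer statement `R[I/a] ≅ R[y_2, …, y_r]/(a y_j − a_j)` for
`H₁`-regular sequences via Koszul complexes; the statement modulo `a` proved here only needs
quasi-regularity and is elementary: if `P(e) ∈ (x_i)` for `e_j = (x_j t)/(x_i t)`, homogenize `P`
with `T_i` into a form `G` of degree `n`; clearing denominators, `T_i^(k+m) G` evaluates at `x`
into `I^(deg+1)`, so by quasi-regularity its coefficients — those of `P` — lie in `I`.

* `chartGen_self`, `chartGen_self_pow_mul`, `reesChartBase_apply_eq_mul_chartGen` —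
  `e_i = 1`, `φ(x_j) = φ(x_i) e_j`;
* `reesChartBase_eq_pow_mul_mk`, `exists_pow_mul_eq_zero_of_reesChartBase_eq_zero` — the basic
  fractions `φ(y) = φ(x_i)ᵐ · (y tᵐ)/(x_i t)ᵐ` and the kernel of `φ : R → (R[It])_{(x_i t)}`
  (`x_i`-power torsion, Stacks 052P);
* `reesChartBase_eval_eq_pow_mul_eval₂` — `φ(F(x)) = φ(x_i)ⁿ F(e)` for forms `F` of degree `n`;
* `exists_isHomogeneous_eval₂_eq`, `eval₂Hom_chartGen_surjective` — the chart ring is generated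
  over `R` by the `e_j`, `j ≠ i` (GW p. 415, Stacks 052P);
* `ker_quotient_comp_eval₂Hom_eq` — for `x` quasi-regular the relations modulo `(x_i)` are
  exactly `I · R[T]`;
* `nonempty_ringEquiv_mvPolynomial_quotient_chart` — **the isomorphism**.

## Sources

* H. Matsumura, *Commutative Ring Theory*, CUP 1986, §16 (quasi-regular sequences, Thm. 16.2).
* The Stacks Project, Tag 052P (affine blowup algebras, Lemmas 10.70.2, 10.70.6), Tag 0BIQ
  (Lemma 15.32.2: blowup algebra of an `H₁`-regular sequence).
* U. Görtz, T. Wedhorn, *Algebraic Geometry I*, 2nd ed. (2020), (13.19) p. 415 (the charts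
  `A[I/f]`), Example 13.95.
-/
noncomputable section

open Polynomial HomogeneousLocalization

namespace Literature.AlgebraicGeometry.Resolution

universe u

variable {R : Type u} [CommRing R] {r : ℕ} (x : Fin r → R) (i : Fin r)

local notation3 "I" => Ideal.span (Set.range x)
local notation3 "B" => HomogeneousLocalization.Away (reesGrading I) (reesT (x i) (Ideal.mem_span_range_self (f := x) (x := i)))
local notation3 "φ" => reesChartBase (x i) (Ideal.mem_span_range_self (f := x) (x := i))

/-- `x_j t ∈ R[It]` has degree `1 = 1 • 1`. [folklore] -/
theorem reesT_mem_one_smul (j : Fin r) : reesT (x j) (Ideal.mem_span_range_self (f := x) (x := j)) ∈ reesGrading I (1 • 1) := by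
  rw [one_smul]; exact reesT_mem (x j) (Ideal.mem_span_range_self (f := x) (x := j))

local notation3 "e[" j "]" =>
  HomogeneousLocalization.Away.mk (reesGrading I) (reesT_mem (x i) (Ideal.mem_span_range_self (f := x) (x := i))) 1
    (reesT (x j) (Ideal.mem_span_range_self (f := x) (x := j))) (reesT_mem_one_smul x j)

/-- `e_i = (x_i t)/(x_i t) = 1`. [folklore] -/
theorem chartGen_self : e[i] = (1 : B) := by
  apply HomogeneousLocalization.val_injective
  rw [HomogeneousLocalization.Away.val_mk, HomogeneousLocalization.val_one, ← Localization.mk_one,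
    Localization.mk_eq_mk_iff, Localization.r_iff_exists]
  exact ⟨1, by simp⟩

/-- `e_iᵏ · w = w` (a form of `e_i = 1` robust against the instance path of `1`). [folklore] -/
theorem chartGen_self_pow_mul (k : ℕ) (w : B) : e[i] ^ k * w = w := by
  apply HomogeneousLocalization.val_injective
  rw [HomogeneousLocalization.val_mul, HomogeneousLocalization.val_pow,
    HomogeneousLocalization.Away.val_mk]
  have h1 : (Localization.mk (reesT (x i) (Ideal.mem_span_range_self (f := x) (x := i)))
      ⟨reesT (x i) (Ideal.mem_span_range_self (f := x) (x := i)) ^ 1, 1, rfl⟩ :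
        Localization (Submonoid.powers (reesT (x i) (Ideal.mem_span_range_self (f := x) (x := i))))) = 1 := by
    rw [← Localization.mk_one, Localization.mk_eq_mk_iff, Localization.r_iff_exists]
    exact ⟨1, by simp⟩
  rw [h1, one_pow, one_mul]

/-- `φ(x_j) = φ(x_i) · e_j` in the chart ring. [folklore] -/
theorem reesChartBase_apply_eq_mul_chartGen (j : Fin r) : φ (x j) = φ (x i) * e[j] := by
  apply HomogeneousLocalization.val_injective
  rw [HomogeneousLocalization.val_mul, val_reesChartBase_eq_mk, val_reesChartBase_eq_mk,
    HomogeneousLocalization.Away.val_mk, Localization.mk_mul, Localization.mk_eq_mk_iff,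
    Localization.r_iff_exists]
  refine ⟨1, Subtype.ext ?_⟩
  simp only [OneMemClass.coe_one, one_mul, Subalgebra.coe_mul, coe_reesT,
    Subalgebra.coe_algebraMap, ← Polynomial.C_eq_algebraMap, pow_one, monomial_mul_C,
    C_mul_monomial]

/-- **The basic fractions**: for `p = y tᵐ ∈ Iᵐ tᵐ`, `φ(y) = φ(x_i)ᵐ · (y tᵐ)/(x_i t)ᵐ` in the chart ring.
[folklore] -/
theorem reesChartBase_eq_pow_mul_mk {m : ℕ} {p : reesAlgebra I} (hp : p ∈ reesGrading I (m • 1))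
    {y : R} (hy : (p : R[X]) = monomial m y) :
    φ y = φ (x i) ^ m *
      HomogeneousLocalization.Away.mk (reesGrading I) (reesT_mem (x i) (Ideal.mem_span_range_self (f := x) (x := i))) m p hp := by
  apply HomogeneousLocalization.val_injective
  rw [HomogeneousLocalization.val_mul, HomogeneousLocalization.val_pow, val_reesChartBase_eq_mk,
    val_reesChartBase_eq_mk, HomogeneousLocalization.Away.val_mk, Localization.mk_pow,
    Localization.mk_mul, Localization.mk_eq_mk_iff, Localization.r_iff_exists]
  refine ⟨1, Subtype.ext ?_⟩
  simp only [OneMemClass.coe_one, one_mul, Subalgebra.coe_mul, coe_reesT,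
    Subalgebra.coe_algebraMap, ← Polynomial.C_eq_algebraMap, SubmonoidClass.coe_pow,
    hy, monomial_pow, one_pow, monomial_mul_C, ← C_pow, C_mul_monomial]

/-- **The kernel of `φ : R → B`**: `φ(c) = 0` forces `x_iᵏ c = 0` for some `k` (elements of the
affine blowup algebra `R[I/a]` are fractions `y/aⁿ`, and `c/1 = 0` iff `aᵏ c = 0`, Stacks 052P).
[cite: StacksProject, Tag 052P] -/
theorem exists_pow_mul_eq_zero_of_reesChartBase_eq_zero {c : R} (hc : φ c = 0) :
    ∃ k : ℕ, x i ^ k * c = 0 := by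
  have h0 := congrArg HomogeneousLocalization.val hc
  rw [val_reesChartBase_eq_mk, HomogeneousLocalization.val_zero, Localization.mk_eq_mk',
    IsLocalization.mk'_eq_zero_iff] at h0
  obtain ⟨⟨_, k, rfl⟩, hk⟩ := h0
  refine ⟨k, ?_⟩
  have := congrArg (fun q : reesAlgebra I => (q : R[X]).coeff k) hk
  simpa only [Subalgebra.coe_mul, Subalgebra.coe_pow, coe_reesT, Subalgebra.coe_algebraMap,
    ← Polynomial.C_eq_algebraMap, monomial_pow, monomial_mul_C, coeff_monomial, if_true,
    ZeroMemClass.coe_zero, coeff_zero, one_pow, mul_one, one_mul] using this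

/-- **Forms of degree `n` in the generators**: for `F ∈ R[T_1, …, T_r]` homogeneous of degree
`n`, `φ(F(x)) = φ(x_i)ⁿ · F(e)` in the chart ring, where `e_j = (x_j t)/(x_i t)` — i.e.
`F(e) = (F(x) tⁿ)/(x_i t)ⁿ`. [folklore] -/
theorem reesChartBase_eval_eq_pow_mul_eval₂ {n : ℕ} {F : MvPolynomial (Fin r) R}
    (hF : F.IsHomogeneous n) :
    φ (MvPolynomial.eval x F) = φ (x i) ^ n * MvPolynomial.eval₂Hom φ (fun j => e[j]) F := by
  classical
  conv_lhs => rw [F.as_sum, map_sum, map_sum]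
  conv_rhs => rw [F.as_sum, map_sum, Finset.mul_sum]
  refine Finset.sum_congr rfl fun α hα => ?_
  have hdeg : α.degree = n := by
    by_contra h
    exact (MvPolynomial.mem_support_iff.mp hα) (hF.coeff_eq_zero h)
  rw [MvPolynomial.eval_monomial, MvPolynomial.coe_eval₂Hom, MvPolynomial.eval₂_monomial, map_mul,
    map_finsuppProd, Finsupp.prod, Finsupp.prod]
  have hφ : ∀ j ∈ α.support, φ (x j ^ α j) = φ (x i) ^ α j * e[j] ^ α j := fun j _ => by
    rw [map_pow, reesChartBase_apply_eq_mul_chartGen x i j]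
    exact mul_pow (M := B) _ _ _
  rw [Finset.prod_congr rfl hφ, Finset.prod_mul_distrib, Finset.prod_pow_eq_pow_sum,
    ← Finsupp.degree_apply, hdeg]
  ring

/-- Every element of the chart ring is `F(e)` for a form `F` (of the degree of its denominator):
`(y tᵐ)/(x_i t)ᵐ = Y(e)` for any form `Y` of degree `m` with `Y(x) = y`. [folklore] -/
theorem exists_isHomogeneous_eval₂_eq (z : B) :
    ∃ (n : ℕ) (F : MvPolynomial (Fin r) R), F.IsHomogeneous n ∧
      MvPolynomial.eval₂Hom φ (fun j => e[j]) F = z := by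
  obtain ⟨m, p, hp, rfl⟩ :=
    HomogeneousLocalization.Away.mk_surjective (reesGrading I) (reesT_mem (x i) (Ideal.mem_span_range_self (f := x) (x := i))) z
  obtain ⟨y, hy⟩ := (mem_reesGrading_iff I).mp hp
  have hm : m • (1 : ℕ) = m := by rw [smul_eq_mul, mul_one]
  rw [hm] at hy
  have hyI : y ∈ I ^ m := reesAlgebra.monomial_mem.mp (hy ▸ p.2)
  obtain ⟨F, hF, hFy⟩ := exists_isHomogeneous_of_mem_span_pow x m hyI
  refine ⟨m, F, hF, ?_⟩
  have h1 := reesChartBase_eval_eq_pow_mul_eval₂ x i hF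
  rw [hFy, reesChartBase_eq_pow_mul_mk x i hp hy.symm] at h1
  have hnzd : φ (x i) ^ m ∈ nonZeroDivisors B :=
    pow_mem (reesChartBase_mem_nonZeroDivisors (x i) (Ideal.mem_span_range_self (f := x) (x := i))) m
  exact (mul_cancel_left_mem_nonZeroDivisors hnzd).mp h1.symm

/-- Killing the variable `T_i` (`T_i ↦ 1`, `T_j ↦ T_j`): the substitution relating forms in
`T_1, …, T_r` to polynomials in the `T_j`, `j ≠ i`. -/
local notation3 "kill" => fun j : Fin r =>
  if h : j = i then (1 : MvPolynomial {j : Fin r // j ≠ i} R) else MvPolynomial.X ⟨j, h⟩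

/-- Evaluating a form at `e` factors through killing `T_i`, as `e_i = 1`. [folklore] -/
theorem eval₂Hom_comp_aeval_kill :
    (MvPolynomial.eval₂Hom φ (fun j : {j : Fin r // j ≠ i} => e[j.1])).comp
        (MvPolynomial.aeval kill).toRingHom =
      MvPolynomial.eval₂Hom φ (fun j => e[j]) := by
  refine MvPolynomial.ringHom_ext (fun c => ?_) (fun j => ?_)
  · change MvPolynomial.eval₂Hom φ _ (MvPolynomial.aeval kill (MvPolynomial.C c)) = _
    rw [MvPolynomial.algHom_C, MvPolynomial.algebraMap_eq, MvPolynomial.eval₂Hom_C,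
      MvPolynomial.eval₂Hom_C]
  · change MvPolynomial.eval₂Hom φ _ (MvPolynomial.aeval kill (MvPolynomial.X j)) = _
    rw [MvPolynomial.aeval_X, MvPolynomial.eval₂Hom_X']
    by_cases h : j = i
    · subst h
      rw [dif_pos rfl, map_one, chartGen_self]
    · rw [dif_neg h, MvPolynomial.eval₂Hom_X']

/-- **The chart ring is generated over `R` by the `e_j`, `j ≠ i`**: the evaluation map
`R[T_j : j ≠ i] → (R[It])_{(x_i t)}`, `T_j ↦ (x_j t)/(x_i t)`, is surjective (GW p. 415:
`A[I/f]` is generated by the `x/f`; Stacks 052P). [cite: StacksProject, Tag 052P] -/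
theorem eval₂Hom_chartGen_surjective :
    Function.Surjective (MvPolynomial.eval₂Hom φ (fun j : {j : Fin r // j ≠ i} => e[j.1])) := by
  intro z
  obtain ⟨n, F, -, hF⟩ := exists_isHomogeneous_eval₂_eq x i z
  refine ⟨MvPolynomial.aeval kill F, ?_⟩
  rw [← hF, ← eval₂Hom_comp_aeval_kill x i]
  rfl

/-- `φ` maps `I` into the principal ideal `(φ x_i)` of the chart ring (`I · R[I/a] = a R[I/a]`,
Stacks 052P). [cite: StacksProject, Tag 052P] -/
theorem reesChartBase_mem_span_of_mem {c : R} (hc : c ∈ I) : φ c ∈ Ideal.span {φ (x i)} := by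
  rw [← span_image_reesChartBase_eq (x i) (Ideal.mem_span_range_self (f := x) (x := i))]
  exact Ideal.subset_span ⟨c, hc, rfl⟩

/-- **The relations modulo the exceptional divisor come from `I`** (the heart of Stacks 0BIQ /
GW p. 415 for quasi-regular sequences): if `x` is quasi-regular (Matsumura §16), the kernel of
`R[T_j : j ≠ i] → (R[It])_{(x_i t)} / (x_i)`, `T_j ↦ (x_j t)/(x_i t)`, is exactly `I · R[T]`.
Proof: if `P(e) ∈ (x_i)`, homogenize `P` with `T_i` to a form `G` of degree `n`; then
`x_iᵐ G(x) tⁿ⁺ᵐ` and `x_iⁿ⁺¹ y tⁿ⁺ᵐ` agree in `R[It]` up to `x_i t`-torsion, so the form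
`T_i^(k+m) G` evaluates into `I^(deg + 1)`, whence its coefficients — those of `P` — lie in `I`
by quasi-regularity. [cite: Matsumura1987, §16 Definition p. 124 and Thm. 16.2] -/
theorem ker_quotient_comp_eval₂Hom_eq (hx : IsQuasiRegular x) :
    RingHom.ker ((Ideal.Quotient.mk (Ideal.span {φ (x i)})).comp
      (MvPolynomial.eval₂Hom φ (fun j : {j : Fin r // j ≠ i} => e[j.1]))) =
      Ideal.map MvPolynomial.C I := by
  classical
  apply le_antisymm
  · intro P hP
    rw [RingHom.mem_ker, RingHom.comp_apply, Ideal.Quotient.eq_zero_iff_mem,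
      Ideal.mem_span_singleton'] at hP
    obtain ⟨z, hz⟩ := hP
    -- homogenize `P` with `T_i` to a form `G` of degree `n`
    set P' : MvPolynomial (Fin r) R := MvPolynomial.rename Subtype.val P with hP'
    set n := P'.totalDegree with hn
    set G : MvPolynomial (Fin r) R := ∑ d ∈ Finset.range (n + 1),
      MvPolynomial.X i ^ (n - d) * MvPolynomial.homogeneousComponent d P' with hG
    have hGhom : G.IsHomogeneous n := by
      refine MvPolynomial.IsHomogeneous.sum _ _ _ fun d hd => ?_
      have hdn : n - d + d = n :=
        Nat.sub_add_cancel (Nat.lt_succ_iff.mp (Finset.mem_range.mp hd))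
      have := (MvPolynomial.isHomogeneous_X_pow i (n - d)).mul
        (MvPolynomial.homogeneousComponent_isHomogeneous d P')
      rwa [hdn] at this
    -- `G(e) = P(e)`
    have hGe : MvPolynomial.eval₂Hom φ (fun j => e[j]) G =
        MvPolynomial.eval₂Hom φ (fun j : {j : Fin r // j ≠ i} => e[j.1]) P := by
      rw [hG, map_sum]
      have : ∀ d ∈ Finset.range (n + 1), MvPolynomial.eval₂Hom φ (fun j => e[j])
          (MvPolynomial.X i ^ (n - d) * MvPolynomial.homogeneousComponent d P') =
          MvPolynomial.eval₂Hom φ (fun j => e[j]) (MvPolynomial.homogeneousComponent d P') := by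
        intro d _
        rw [map_mul, map_pow, MvPolynomial.eval₂Hom_X']
        exact chartGen_self_pow_mul x i _ _
      rw [Finset.sum_congr rfl this, ← map_sum, MvPolynomial.sum_homogeneousComponent, hP',
        MvPolynomial.eval₂Hom_rename]
      rfl
    -- the element `z = (y tᵐ)/(x_i t)ᵐ`
    obtain ⟨m, p, hp, rfl⟩ := HomogeneousLocalization.Away.mk_surjective (reesGrading I)
      (reesT_mem (x i) (Ideal.mem_span_range_self (f := x) (x := i))) z
    obtain ⟨y, hy⟩ := (mem_reesGrading_iff I).mp hp
    have hm : m • (1 : ℕ) = m := by rw [smul_eq_mul, mul_one]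
    rw [hm] at hy
    have hyI : y ∈ I ^ m := reesAlgebra.monomial_mem.mp (hy ▸ p.2)
    have h5 := reesChartBase_eq_pow_mul_mk x i hp hy.symm
    have h3 := reesChartBase_eval_eq_pow_mul_eval₂ x i hGhom
    -- `φ (x_iᵐ G(x) - x_iⁿ⁺¹ y) = 0`, so `x_iᵏ (x_iᵐ G(x) - x_iⁿ⁺¹ y) = 0` for some `k`
    have hφeq : φ (x i ^ m * MvPolynomial.eval x G - x i ^ (n + 1) * y) = 0 := by
      rw [map_sub, map_mul, map_mul, map_pow, map_pow, h3, hGe, ← hz, h5]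
      ring
    obtain ⟨k, hk⟩ := exists_pow_mul_eq_zero_of_reesChartBase_eq_zero x i hφeq
    -- the form `H = T_i^(k+m) G` of degree `k+m+n` has `H(x) ∈ I^(k+m+n+1)`
    set H : MvPolynomial (Fin r) R := MvPolynomial.X i ^ (k + m) * G with hH
    have hHhom : H.IsHomogeneous (k + m + n) :=
      (MvPolynomial.isHomogeneous_X_pow i (k + m)).mul hGhom
    have hHx : MvPolynomial.eval x H ∈ I ^ (k + m + n + 1) := by
      have e1 : MvPolynomial.eval x H = x i ^ k * x i ^ (n + 1) * y := by
        rw [mul_sub, sub_eq_zero, ← mul_assoc, ← pow_add, ← mul_assoc, ← pow_add] at hk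
        rw [hH, map_mul, map_pow, MvPolynomial.eval_X, hk, pow_add]
      rw [e1, show k + m + n + 1 = k + (n + 1) + m by ring, pow_add, pow_add]
      exact Ideal.mul_mem_mul (Ideal.mul_mem_mul (Ideal.pow_mem_pow (Ideal.mem_span_range_self (f := x) (x := i)) k)
        (Ideal.pow_mem_pow (Ideal.mem_span_range_self (f := x) (x := i)) (n + 1))) hyI
    have hHI : H ∈ Ideal.map MvPolynomial.C I := hx (k + m + n) H hHhom hHx
    -- kill `T_i`: `P = H(T_i := 1)` and killing `T_i` preserves `I · R[T]`
    have hkillC : (MvPolynomial.aeval kill : MvPolynomial (Fin r) R →ₐ[R]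
        MvPolynomial {j : Fin r // j ≠ i} R).toRingHom.comp MvPolynomial.C = MvPolynomial.C := by
      refine RingHom.ext fun c => ?_
      change MvPolynomial.aeval kill (MvPolynomial.C c) = MvPolynomial.C c
      rw [MvPolynomial.algHom_C, MvPolynomial.algebraMap_eq]
    have hPH : P = MvPolynomial.aeval kill H := by
      rw [hH, map_mul, map_pow, MvPolynomial.aeval_X, dif_pos rfl, one_pow, one_mul, hG, map_sum]
      have : ∀ d ∈ Finset.range (n + 1), MvPolynomial.aeval kill
          (MvPolynomial.X i ^ (n - d) * MvPolynomial.homogeneousComponent d P') =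
          MvPolynomial.aeval kill (MvPolynomial.homogeneousComponent d P') := by
        intro d _
        rw [map_mul, map_pow, MvPolynomial.aeval_X, dif_pos rfl, one_pow, one_mul]
      rw [Finset.sum_congr rfl this, ← map_sum, MvPolynomial.sum_homogeneousComponent, hP',
        MvPolynomial.aeval_rename]
      have hfun : ((kill) ∘ (Subtype.val : {j : Fin r // j ≠ i} → Fin r)) = MvPolynomial.X := by
        funext j
        change (kill) j.1 = _
        exact dif_neg j.2
      rw [hfun, MvPolynomial.aeval_X_left_apply]
    rw [hPH]
    have := Ideal.mem_map_of_mem (MvPolynomial.aeval kill : MvPolynomial (Fin r) R →ₐ[R]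
        MvPolynomial {j : Fin r // j ≠ i} R).toRingHom hHI
    rwa [Ideal.map_map, hkillC] at this
  · rw [Ideal.map_le_iff_le_comap]
    intro c hc
    rw [Ideal.mem_comap, RingHom.mem_ker, RingHom.comp_apply, MvPolynomial.eval₂Hom_C,
      Ideal.Quotient.eq_zero_iff_mem]
    exact reesChartBase_mem_span_of_mem x i hc

/-- The composite `R[T_j : j ≠ i] → (R[It])_{(x_i t)} → (R[It])_{(x_i t)}/(x_i)` is surjective.
[folklore] -/
theorem quotient_comp_eval₂Hom_surjective :
    Function.Surjective ((Ideal.Quotient.mk (Ideal.span {φ (x i)})).comp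
      (MvPolynomial.eval₂Hom φ (fun j : {j : Fin r // j ≠ i} => e[j.1]))) :=
  Ideal.Quotient.mk_surjective.comp (eval₂Hom_chartGen_surjective x i)

/-- **The chart of the blowing up of a quasi-regular sequence modulo the exceptional divisor is
a polynomial ring over the centre**: for `x = (x_1, …, x_r)` quasi-regular in `R` (e.g. an
`R`-sequence, Matsumura Thm. 16.2), `I = (x)`, and the chart `D₊(x_i t) = Spec (R[It])_{(x_i t)}`
of `Bl_I(Spec R) = Proj R[It]` (`AffineBlowup.lean`), on which the exceptional divisor is cut out
by the regular element `x_i` (`reesChartBase_mem_nonZeroDivisors`, `span_image_reesChartBase_eq`),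
`(R[It])_{(x_i t)} / (x_i) ≅ (R/I)[T_j : j ≠ i]` — the exceptional divisor of the blowing up
along a quasi-regular centre is, chart by chart, an affine space over the centre (Stacks 0BIQ:
`R[I/a] ≅ R[y_2, …, y_r]/(a y_j − a_j)` for `H₁`-regular sequences, reduced modulo `a`).
[cite: StacksProject, Tag 0BIQ] [cite: Matsumura1987, Thm. 16.2] -/
theorem nonempty_ringEquiv_mvPolynomial_quotient_chart (hx : IsQuasiRegular x) :
    Nonempty (MvPolynomial {j : Fin r // j ≠ i} (R ⧸ I) ≃+* B ⧸ Ideal.span {φ (x i)}) :=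
  ⟨(MvPolynomial.quotientEquivQuotientMvPolynomial I).toRingEquiv.trans
    ((Ideal.quotEquivOfEq (ker_quotient_comp_eval₂Hom_eq x i hx).symm).trans
      (RingHom.quotientKerEquivOfSurjective (quotient_comp_eval₂Hom_surjective x i)))⟩

end Literature.AlgebraicGeometry.Resolution

end
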